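import Summits.MatrixMultiplication.MatrixMultiplication.Theorems.ConeTensorCore
import HarnessLib

/-!
# ConeTensorApexCones — the four apex cones (part 1 of 3)

(decomp-mm lens 6 «barrier-complement carving», gen 14; kernel of the node `ConeCarving`.
Part 1 (this file): the cones `cone^{(a)}`, `a = 1,2,3`, and their relabelling to `cone = cone^{(0)}`;
part 2 `ConeTensorApex`: the fourfold product and `T(K₄)_{(n·n)³}` as its pullback; part 3
`ConeTensorApexExponent`: `ω(K₄) ≤ (2/3)·ω(W)`, `ConeFlat ⟹ TetraFlat`, `ω(W) ≤ 2·ω(K₄)`.)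

In the language of Christandl–Vrana–Zuiddam (arXiv:1609.07476, §2.1) the cone `W_n = cone F n` is
the NONUNIFORM graph tensor `T_f(K₄)` with edge weights `f = (n², n², n², n, n, n)` (squared spokes
at the apex `0`, plain rim), padded into the format of `T(K₄)_{n·n}`; their Prop. 2.1.7
(`τ(T(G)) ≤ log_N R(T_f(G))` for edge-transitive `G`, `N = ∏_e f(e) = n⁹`) gives
`ω(K₄) ≤ (2/3)·ω(W)`. These three files re-prove that inequality in kernel through the apex
sub-orbit: `T(K₄)_{n·n} = ∏_t face_t` (`tetra_sq_apply`, `t` = missing vertex) regroups for EVERY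
apex `a` as `face_a · cone^{(a)}` with `cone^{(a)} = ∏_{t ≠ a} face_t`; each `cone^{(a)}` is `cone`
with legs permuted and slots/halves relabelled (`cone₁_eq`, `cone₂_eq`, `cone₃_eq`), so it has a
rank-one decomposition of length `R₄(W_n)` (`exists_rankOne_decompositions_apex`). The product of
the four apex cones on disjoint coordinates has `R₄ ≤ R₄(W_n)⁴`, and `T(K₄)` at level
`(n·n)³ = n⁶` is a pullback of it (every edge `{v,w}` is a spoke of the two cones with apex in
`{v,w}` and a rim edge of the other two: `2+2+1+1 = 6` labels of size `n`). Hence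
`R₄(T(K₄)_{n⁶}) ≤ R₄(W_n)⁴`, `ω(K₄) ≤ (2/3)·ω(W)` and `ConeFlat ⟹ TetraFlat` (`ω(W) ≤ 6 → ω(K₄) ≤ 4`).
Together with `ConeTensorResidual` (`TetraNoSaving ⟹ ConeNoSaving`): the spoke deformation
`s = 1 ↦ 2` moves strength from the residual to the attacked conjunct, monotonically, in kernel.

Sources: [CVZ19] Christandl–Vrana–Zuiddam, comput. complexity 28 (2019), arXiv:1609.07476,
Prop. 1.1.16, Prop. 1.1.26, §2.1 (nonuniform `T_f(G)`), Prop. 2.1.7. No `sorry`, no new axiom, no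
instance, no notation, no `Prop`-valued definition.
-/

noncomputable section

set_option linter.dupNamespace false

open scoped BigOperators
open Filter Asymptotics Module
open Literature.Computability.AlgebraicComplexity
open Summit.MatrixMultiplication.MatrixMultiplication.Theorems.TetrahedronTensor

namespace Summit.MatrixMultiplication.MatrixMultiplication.Theorems.ConeTensor

/-! ## Label bookkeeping at the square level -/

section Labels

variable {n : ℕ}

/-- First half of slot `0` of an encoded label. [folklore] -/
theorem P₁_enc₀ (a b c : Fin (n * n)) : P₁ (enc a b c) 0 = (finProdFinEquiv.symm a).1 := by
  simp [P₁]

/-- First half of slot `1` of an encoded label. [folklore] -/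
theorem P₁_enc₁ (a b c : Fin (n * n)) : P₁ (enc a b c) 1 = (finProdFinEquiv.symm b).1 := by
  simp [P₁]

/-- First half of slot `2` of an encoded label. [folklore] -/
theorem P₁_enc₂ (a b c : Fin (n * n)) : P₁ (enc a b c) 2 = (finProdFinEquiv.symm c).1 := by
  simp [P₁]

/-- Second half of slot `0` of an encoded label. [folklore] -/
theorem P₂_enc₀ (a b c : Fin (n * n)) : P₂ (enc a b c) 0 = (finProdFinEquiv.symm a).2 := by
  simp [P₂]

/-- Second half of slot `1` of an encoded label. [folklore] -/
theorem P₂_enc₁ (a b c : Fin (n * n)) : P₂ (enc a b c) 1 = (finProdFinEquiv.symm b).2 := by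
  simp [P₂]

/-- Second half of slot `2` of an encoded label. [folklore] -/
theorem P₂_enc₂ (a b c : Fin (n * n)) : P₂ (enc a b c) 2 = (finProdFinEquiv.symm c).2 := by
  simp [P₂]

/-- Swap the two halves of a pair label. -/
def hsw (y : Fin (n * n)) : Fin (n * n) :=
  finProdFinEquiv ((finProdFinEquiv.symm y).2, (finProdFinEquiv.symm y).1)

/-- `hsw` swaps the halves (first). [folklore] -/
theorem fst_hsw (y : Fin (n * n)) : (finProdFinEquiv.symm (hsw y)).1 = (finProdFinEquiv.symm y).2 := by
  simp [hsw]

/-- `hsw` swaps the halves (second). [folklore] -/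
theorem snd_hsw (y : Fin (n * n)) : (finProdFinEquiv.symm (hsw y)).2 = (finProdFinEquiv.symm y).1 := by
  simp [hsw]

/-- Leg relabelling `(y₀, y₁, y₂) ↦ (y₁, y₀, swap y₂)`. -/
def τ (x : Fin ((n * n) ^ 3)) : Fin ((n * n) ^ 3) :=
  enc (finFunctionFinEquiv.symm x 1) (finFunctionFinEquiv.symm x 0) (hsw (finFunctionFinEquiv.symm x 2))

/-- Leg relabelling `(y₀, y₁, y₂) ↦ (y₂, swap y₀, swap y₁)`. -/
def ρ (x : Fin ((n * n) ^ 3)) : Fin ((n * n) ^ 3) :=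
  enc (finFunctionFinEquiv.symm x 2) (hsw (finFunctionFinEquiv.symm x 0))
    (hsw (finFunctionFinEquiv.symm x 1))

/-- Slot/half bookkeeping for the relabelling in `P₁_τ₀`. [folklore] -/
theorem P₁_τ₀ (x : Fin ((n * n) ^ 3)) : P₁ (τ x) 0 = P₁ x 1 := by rw [τ, P₁_enc₀]; rfl
/-- Slot/half bookkeeping for the relabelling in `P₂_τ₀`. [folklore] -/
theorem P₂_τ₀ (x : Fin ((n * n) ^ 3)) : P₂ (τ x) 0 = P₂ x 1 := by rw [τ, P₂_enc₀]; rfl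
/-- Slot/half bookkeeping for the relabelling in `P₁_τ₁`. [folklore] -/
theorem P₁_τ₁ (x : Fin ((n * n) ^ 3)) : P₁ (τ x) 1 = P₁ x 0 := by rw [τ, P₁_enc₁]; rfl
/-- Slot/half bookkeeping for the relabelling in `P₂_τ₁`. [folklore] -/
theorem P₂_τ₁ (x : Fin ((n * n) ^ 3)) : P₂ (τ x) 1 = P₂ x 0 := by rw [τ, P₂_enc₁]; rfl
/-- Slot/half bookkeeping for the relabelling in `P₁_τ₂`. [folklore] -/
theorem P₁_τ₂ (x : Fin ((n * n) ^ 3)) : P₁ (τ x) 2 = P₂ x 2 := by rw [τ, P₁_enc₂, fst_hsw]; rfl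
/-- Slot/half bookkeeping for the relabelling in `P₂_τ₂`. [folklore] -/
theorem P₂_τ₂ (x : Fin ((n * n) ^ 3)) : P₂ (τ x) 2 = P₁ x 2 := by rw [τ, P₂_enc₂, snd_hsw]; rfl
/-- Slot/half bookkeeping for the relabelling in `P₁_ρ₀`. [folklore] -/
theorem P₁_ρ₀ (x : Fin ((n * n) ^ 3)) : P₁ (ρ x) 0 = P₁ x 2 := by rw [ρ, P₁_enc₀]; rfl
/-- Slot/half bookkeeping for the relabelling in `P₂_ρ₀`. [folklore] -/
theorem P₂_ρ₀ (x : Fin ((n * n) ^ 3)) : P₂ (ρ x) 0 = P₂ x 2 := by rw [ρ, P₂_enc₀]; rfl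
/-- Slot/half bookkeeping for the relabelling in `P₁_ρ₁`. [folklore] -/
theorem P₁_ρ₁ (x : Fin ((n * n) ^ 3)) : P₁ (ρ x) 1 = P₂ x 0 := by rw [ρ, P₁_enc₁, fst_hsw]; rfl
/-- Slot/half bookkeeping for the relabelling in `P₂_ρ₁`. [folklore] -/
theorem P₂_ρ₁ (x : Fin ((n * n) ^ 3)) : P₂ (ρ x) 1 = P₁ x 0 := by rw [ρ, P₂_enc₁, snd_hsw]; rfl
/-- Slot/half bookkeeping for the relabelling in `P₁_ρ₂`. [folklore] -/
theorem P₁_ρ₂ (x : Fin ((n * n) ^ 3)) : P₁ (ρ x) 2 = P₂ x 1 := by rw [ρ, P₁_enc₂, fst_hsw]; rfl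
/-- Slot/half bookkeeping for the relabelling in `P₂_ρ₂`. [folklore] -/
theorem P₂_ρ₂ (x : Fin ((n * n) ^ 3)) : P₂ (ρ x) 2 = P₁ x 1 := by rw [ρ, P₂_enc₂, snd_hsw]; rfl

end Labels

/-! ## The apex cones `cone^{(1)}, cone^{(2)}, cone^{(3)}` and their relabelling to `cone = cone^{(0)}` -/

section ApexCones

variable (F : Type*) [Field F]

/-- The cone with apex `1`: product of the faces missing `0`, `2`, `3` of `tetra_sq_apply`. (CVZ19, Prop. 1.1.26 (proof)). -/
def cone₁ (n : ℕ) : (Fin 4 → Fin ((n * n) ^ 3)) → F := fun i =>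
  matMulTensor F n n n (P₂ (i 1) 1, P₂ (i 1) 2) (P₂ (i 2) 1, P₂ (i 2) 2) (P₂ (i 3) 2, P₂ (i 3) 1) *
  matMulTensor F n n n (P₂ (i 0) 0, P₁ (i 0) 2) (P₂ (i 1) 0, P₁ (i 1) 2) (P₁ (i 3) 1, P₁ (i 3) 0) *
  matMulTensor F n n n (P₁ (i 0) 0, P₁ (i 0) 1) (P₁ (i 1) 0, P₁ (i 1) 1) (P₁ (i 2) 1, P₁ (i 2) 0)

/-- The cone with apex `2`: product of the faces missing `0`, `1`, `3`. (CVZ19, Prop. 1.1.26 (proof)). -/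
def cone₂ (n : ℕ) : (Fin 4 → Fin ((n * n) ^ 3)) → F := fun i =>
  matMulTensor F n n n (P₂ (i 1) 1, P₂ (i 1) 2) (P₂ (i 2) 1, P₂ (i 2) 2) (P₂ (i 3) 2, P₂ (i 3) 1) *
  matMulTensor F n n n (P₂ (i 0) 1, P₂ (i 0) 2) (P₂ (i 2) 0, P₁ (i 2) 2) (P₁ (i 3) 2, P₂ (i 3) 0) *
  matMulTensor F n n n (P₁ (i 0) 0, P₁ (i 0) 1) (P₁ (i 1) 0, P₁ (i 1) 1) (P₁ (i 2) 1, P₁ (i 2) 0)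

/-- The cone with apex `3`: product of the faces missing `0`, `1`, `2`. (CVZ19, Prop. 1.1.26 (proof)). -/
def cone₃ (n : ℕ) : (Fin 4 → Fin ((n * n) ^ 3)) → F := fun i =>
  matMulTensor F n n n (P₂ (i 1) 1, P₂ (i 1) 2) (P₂ (i 2) 1, P₂ (i 2) 2) (P₂ (i 3) 2, P₂ (i 3) 1) *
  matMulTensor F n n n (P₂ (i 0) 1, P₂ (i 0) 2) (P₂ (i 2) 0, P₁ (i 2) 2) (P₁ (i 3) 2, P₂ (i 3) 0) *
  matMulTensor F n n n (P₂ (i 0) 0, P₁ (i 0) 2) (P₂ (i 1) 0, P₁ (i 1) 2) (P₁ (i 3) 1, P₁ (i 3) 0)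

variable {F}

/-- `T(K₄)_{n·n} = face₁ · cone^{(1)}` (regrouping `tetra_sq_apply`). [folklore] -/
theorem tetra_sq_eq_face_mul_cone₁ {n : ℕ} (i : Fin 4 → Fin ((n * n) ^ 3)) :
    tetra F (n * n) i =
      matMulTensor F n n n (P₂ (i 0) 1, P₂ (i 0) 2) (P₂ (i 2) 0, P₁ (i 2) 2) (P₁ (i 3) 2, P₂ (i 3) 0) *
        cone₁ F n i := by
  rw [tetra_sq_apply]; simp only [cone₁]; ring

/-- `T(K₄)_{n·n} = face₂ · cone^{(2)}`. [folklore] -/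
theorem tetra_sq_eq_face_mul_cone₂ {n : ℕ} (i : Fin 4 → Fin ((n * n) ^ 3)) :
    tetra F (n * n) i =
      matMulTensor F n n n (P₂ (i 0) 0, P₁ (i 0) 2) (P₂ (i 1) 0, P₁ (i 1) 2) (P₁ (i 3) 1, P₁ (i 3) 0) *
        cone₂ F n i := by
  rw [tetra_sq_apply]; simp only [cone₂]; ring

/-- `T(K₄)_{n·n} = face₃ · cone^{(3)}`. [folklore] -/
theorem tetra_sq_eq_face_mul_cone₃ {n : ℕ} (i : Fin 4 → Fin ((n * n) ^ 3)) :
    tetra F (n * n) i =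
      matMulTensor F n n n (P₁ (i 0) 0, P₁ (i 0) 1) (P₁ (i 1) 0, P₁ (i 1) 1) (P₁ (i 2) 1, P₁ (i 2) 0) *
        cone₃ F n i := by
  rw [tetra_sq_apply]; simp only [cone₃]; ring

/-- `cone^{(1)}` is `cone` with legs `0 ↔ 1` exchanged and legs `2, 3` relabelled by `τ`. [folklore] -/
theorem cone₁_eq {n : ℕ} (i : Fin 4 → Fin ((n * n) ^ 3)) :
    cone₁ F n i = cone F n ![i 1, i 0, τ (i 2), τ (i 3)] := by
  simp only [cone, cone₁, matMulTensor, ite_one_zero_mul_ite]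
  refine if_congr ?_ rfl rfl
  simp only [Matrix.cons_val_zero, Matrix.cons_val_one, Matrix.cons_val_two, Matrix.cons_val_three,
    Matrix.head_cons, Matrix.tail_cons, P₁_τ₀, P₂_τ₀, P₁_τ₁, P₁_τ₂,
    @eq_comm _ (P₂ (i 1) 0) (P₂ (i 0) 0), @eq_comm _ (P₁ (i 1) 0) (P₁ (i 0) 0)]
  tauto

/-- `cone^{(2)}` is `cone` with legs `(0,1,2,3) ↦ (2,0,1,3)` and relabellings `τ, τ, ρ`. [folklore] -/
theorem cone₂_eq {n : ℕ} (i : Fin 4 → Fin ((n * n) ^ 3)) :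
    cone₂ F n i = cone F n ![i 2, τ (i 0), τ (i 1), ρ (i 3)] := by
  simp only [cone, cone₂, matMulTensor, ite_one_zero_mul_ite]
  refine if_congr ?_ rfl rfl
  simp only [Matrix.cons_val_zero, Matrix.cons_val_one, Matrix.cons_val_two, Matrix.cons_val_three,
    Matrix.head_cons, Matrix.tail_cons, P₁_τ₀, P₂_τ₀, P₁_τ₁, P₁_τ₂, P₁_ρ₀, P₂_ρ₀, P₁_ρ₁, P₁_ρ₂,
    @eq_comm _ (P₂ (i 2) 1) (P₂ (i 1) 1), @eq_comm _ (P₂ (i 2) 0) (P₂ (i 0) 1),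
    @eq_comm _ (P₁ (i 2) 0) (P₁ (i 0) 1), @eq_comm _ (P₁ (i 2) 1) (P₁ (i 1) 1)]
  tauto

/-- `cone^{(3)}` is `cone` with legs `(0,1,2,3) ↦ (3,0,1,2)` and relabellings `ρ, ρ, ρ`. [folklore] -/
theorem cone₃_eq {n : ℕ} (i : Fin 4 → Fin ((n * n) ^ 3)) :
    cone₃ F n i = cone F n ![i 3, ρ (i 0), ρ (i 1), ρ (i 2)] := by
  simp only [cone, cone₃, matMulTensor, ite_one_zero_mul_ite]
  refine if_congr ?_ rfl rfl
  simp only [Matrix.cons_val_zero, Matrix.cons_val_one, Matrix.cons_val_two, Matrix.cons_val_three,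
    Matrix.head_cons, Matrix.tail_cons, P₁_ρ₀, P₂_ρ₀, P₁_ρ₁, P₁_ρ₂,
    @eq_comm _ (P₂ (i 3) 1) (P₂ (i 1) 2), @eq_comm _ (P₂ (i 3) 2) (P₂ (i 2) 2),
    @eq_comm _ (P₂ (i 3) 0) (P₂ (i 0) 2), @eq_comm _ (P₁ (i 3) 2) (P₁ (i 2) 2),
    @eq_comm _ (P₁ (i 3) 0) (P₁ (i 0) 2), @eq_comm _ (P₁ (i 3) 1) (P₁ (i 1) 2)]
  tauto

/-- Rank-one decompositions of length `R₄(W_n)` for all four apex cones. [folklore] -/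
theorem exists_rankOne_decompositions_apex (n : ℕ) :
    ∃ u₀ u₁ u₂ u₃ : Fin (tensorRankD (cone F n)) → Fin 4 → Fin ((n * n) ^ 3) → F,
      ∑ k, rankOneTensor (u₀ k) = cone F n ∧ ∑ k, rankOneTensor (u₁ k) = cone₁ F n ∧
      ∑ k, rankOneTensor (u₂ k) = cone₂ F n ∧ ∑ k, rankOneTensor (u₃ k) = cone₃ F n := by
  classical
  obtain ⟨u, hu⟩ := exists_rankOne_decomposition_cone (F := F) n
  refine ⟨u, fun k => ![u k 1, u k 0, fun x => u k 2 (τ x), fun x => u k 3 (τ x)],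
    fun k => ![fun x => u k 1 (τ x), fun x => u k 2 (τ x), u k 0, fun x => u k 3 (ρ x)],
    fun k => ![fun x => u k 1 (ρ x), fun x => u k 2 (ρ x), fun x => u k 3 (ρ x), u k 0],
    hu, ?_, ?_, ?_⟩
  · funext i
    rw [Finset.sum_apply, cone₁_eq, ← congrFun hu _, Finset.sum_apply]
    refine Finset.sum_congr rfl fun k _ => ?_
    rw [rankOneTensor_apply, rankOneTensor_apply, Fin.prod_univ_four, Fin.prod_univ_four]
    simp only [Matrix.cons_val_zero, Matrix.cons_val_one, Matrix.cons_val_two, Matrix.cons_val_three,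
      Matrix.head_cons, Matrix.tail_cons]
    ring
  · funext i
    rw [Finset.sum_apply, cone₂_eq, ← congrFun hu _, Finset.sum_apply]
    refine Finset.sum_congr rfl fun k _ => ?_
    rw [rankOneTensor_apply, rankOneTensor_apply, Fin.prod_univ_four, Fin.prod_univ_four]
    simp only [Matrix.cons_val_zero, Matrix.cons_val_one, Matrix.cons_val_two, Matrix.cons_val_three,
      Matrix.head_cons, Matrix.tail_cons]
    ring
  · funext i
    rw [Finset.sum_apply, cone₃_eq, ← congrFun hu _, Finset.sum_apply]
    refine Finset.sum_congr rfl fun k _ => ?_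
    rw [rankOneTensor_apply, rankOneTensor_apply, Fin.prod_univ_four, Fin.prod_univ_four]
    simp only [Matrix.cons_val_zero, Matrix.cons_val_one, Matrix.cons_val_two, Matrix.cons_val_three,
      Matrix.head_cons, Matrix.tail_cons]
    ring

end ApexCones

end Summit.MatrixMultiplication.MatrixMultiplication.Theorems.ConeTensor

end
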